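import Literature.Computability.Complexity.BoolEncodings
import Literature.Computability.Complexity.Classes
import Literature.Computability.Complexity.Nondeterministic
import Literature.Computability.Complexity.Randomized
import HarnessLib

-- provenance: harness21/H21/H21/Prelude/CplxCore/ProbabilisticClasses.lean @ 399d27b (interim HEAD d8f2665); M5 mechanical rewrite
/-!
# Complexity core: probabilistic class operators and classes

Trunk `CplxCore`, concept C8 (`ProbabilisticClasses`; realises the notions `class_BPP` and the
`PP` half of `class_PP_sharpP`). Following outline D3, randomness at the level of classes of
languages `Set (Language Bool)` is introduced by *class operators* using the fixed pairing
`boolPair` and the counting probability `uniformProb` (file `Randomized.lean`):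

* `bp C` — two-sided bounded error (`BPP = bp P`, `AM = bp NP`);
* `rp C` — one-sided error (`RP = rp P`, `coRP = co RP`, `ZPP = RP ∩ coRP`);
* `pMajority C` — majority / unbounded error (`PP = pMajority P`).

API: `P_subset_BPP`, `RP_subset_NP`, `RP_subset_BPP`, `BPP_subset_PP`, `NP_subset_PP`, `co_BPP`,
`bp_mono`, and the machine (Gill) characterisations `mem_BPP_iff_randAlg`,
`mem_ZPP_iff_expectedTime` in terms of `RandAlg`; the coin-truncation normal form
`RandAlg.truncate` (with `outputPMF_truncate`, `pr_truncate`, `pr_ne_eq_one_sub`, proved), and the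
named facts `polyTimeComputable_boolPair_take` (truncation is polynomial time) and
`exists_randAlg_error_le_of_mem_BPP` (error reduction for `BPP` down to any constant).

Mathlib has no complexity classes (searched `BPP`, `PP`, `ZPP`, probabilistic Turing machines:
nothing). We reuse `Polynomial.eval`, `Set.boolIndicator`, `Computability.encodeBool` and the
H21 notions `uniformProb`, `RandAlg`, `P`, `NP`, `co`.

## Design notes

* In `bp`, the event is `{y | (boolPair x y ∈ L' ↔ x ∈ L)}` with `↔` inside `setOf`
  (review F13b), i.e. "the verdict on coins `y` is correct".
* Operator classes impose their acceptance-gap condition on **all** inputs (outline D3,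
  review F3). Hence there is no `MA` (`polyExists (bp P)` is `∃·BPP`, which differs from `MA`
  relative to oracles; `MA` is promise-style), while `AM := bp NP` is the operator class
  `BP·NP`, equal to two-round Arthur–Merlin games (Babai–Moran 1988; Goldwasser–Sipser 1986).
* `ZPP := RP ∩ coRP` is a theorem-as-definition: Gill defines `ZPP` by zero-error expected
  polynomial-time machines and proves `ZPP = RP ∩ coRP`; the expected-time form is recorded as
  the (sorried) lemma `mem_ZPP_iff_expectedTime` using `RandAlg.RunsInExpectedTime`.
* In `rp` the "no false positives" clause quantifies over coin strings of the exact length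
  `p |x|` (the strings that `uniformProb (p |x|)` samples). More generally all three
  operators only look at strings of `L'` of the form `boolPair x y` with `|y| = p |x|`;
  membership in `L'` of other strings is irrelevant (harmless, since `boolPair` is injective
  with polynomial-time recognisable image).
* In the machine characterisations `mem_BPP_iff_randAlg`, `mem_ZPP_iff_expectedTime` the
  coin budget `A.coinLen` is required to be *exactly* a polynomial (not merely polynomially
  bounded): `RandAlg.coinLen` is an arbitrary function `ℕ → ℕ`, and `A.run` can read `|r|`,
  so a bounded but non-computable budget would leak one uncomputable bit per input length.
* The constants `2/3`, `1/2` are the textbook ones. Error reduction for `BPP` down to any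
  constant error `ε > 0` is the named fact `exists_randAlg_error_le_of_mem_BPP` (machine form);
  the full printed strength `1 - 2^{-|x|^d}` (Arora–Barak Thm. 7.10) is not stated.
* Universe convention (outline D7): everything lives over `List Bool`; classes mentioning `P`
  are `noncomputable`.

## References

* J. Gill, *Computational complexity of probabilistic Turing machines*, SIAM J. Comput. 6
  (1977), Def. 5.1–5.2 (PP, BPP, RP = VPP, ZPP), Thm. 5.2(ii) (`ZPP = RP ∩ coRP`),
  Prop. 5.1/Thm. 6.5 (`P ⊆ ZPP ⊆ RP ⊆ BPP ⊆ PP`, `NP ⊆ PP`).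
* S. Arora, B. Barak, *Computational Complexity: A Modern Approach*, CUP 2009, Def. 7.2–7.3
  (BPP, alternative definition with random strings), Def. 7.6 (RP, coRP), Def. 7.7 (ZPP),
  §17.2.1 (PP), Def. 8.10 and Remark 8.11 (AM = BP·NP), Ex. 7.5–7.6.
* L. Babai, S. Moran, *Arthur–Merlin games: a randomized proof system, and a hierarchy of
  complexity classes*, JCSS 36 (1988).
* S. Goldwasser, M. Sipser, *Private coins versus public coins in interactive proof systems*,
  STOC 1986.
* U. Schöning, *Probabilistic complexity classes and lowness*, JCSS 39 (1989) (the `BP·`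
  operator).
-/

namespace Literature.Computability.Complexity

open _root_.Computability

/-! ### Probabilistic class operators -/

/-- The bounded-error probabilistic operator `BP·C`: `L ∈ bp C` iff there are `L' ∈ C` and a
polynomial `p` such that for every input `x`, at least `2/3` of the coin strings `y` of length
`p |x|` give the correct verdict, `boolPair x y ∈ L' ↔ x ∈ L`. Thus `BPP = bp P` and
`AM = bp NP`. [Arora–Barak 2009, Def. 7.3 (BPP via random strings) and Def. 8.10/Remark 8.11
(BP·NP); Schöning 1989 (BP operator)] [cite: AroraBarak2009, Def. 7.3 (BPP via random strings] -/
def bp (C : Set (Language Bool)) : Set (Language Bool) :=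
  {L | ∃ L' ∈ C, ∃ p : Polynomial ℕ, ∀ x : List Bool,
    2 / 3 ≤ uniformProb (p.eval x.length) {y : List Bool | boolPair x y ∈ L' ↔ x ∈ L}}

/-- The one-sided-error probabilistic operator `R·C`: `L ∈ rp C` iff there are `L' ∈ C` and a
polynomial `p` such that for every `x ∈ L` at least half of the coin strings `y` of length
`p |x|` have `boolPair x y ∈ L'`, and for every `x ∉ L` no coin string `y` of length `p |x|`
has `boolPair x y ∈ L'`. Thus `RP = rp P`. [Arora–Barak 2009, Def. 7.6 (RP); Gill 1977,
Def. 5.1 (VPP)] [cite: AroraBarak2009, Def. 7.6 (RP] -/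
def rp (C : Set (Language Bool)) : Set (Language Bool) :=
  {L | ∃ L' ∈ C, ∃ p : Polynomial ℕ, ∀ x : List Bool,
    (x ∈ L → 1 / 2 ≤ uniformProb (p.eval x.length) {y : List Bool | boolPair x y ∈ L'}) ∧
    (x ∉ L → ∀ y : List Bool, y.length = p.eval x.length → boolPair x y ∉ L')}

/-- The majority (unbounded-error) probabilistic operator `P·C`: `L ∈ pMajority C` iff there are
`L' ∈ C` and a polynomial `p` such that `x ∈ L` iff strictly more than half of the coin strings
`y` of length `p |x|` have `boolPair x y ∈ L'`. Thus `PP = pMajority P`. We follow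
Gill's strict threshold `> 1/2`; Arora–Barak use acceptance probability `≥ 1/2`, which
yields the same class. [Gill 1977, Def. 5.1 (PP); Arora–Barak 2009, §17.2.1 (the class PP)] [cite: Gill1977, Def. 5.1 (PP] -/
def pMajority (C : Set (Language Bool)) : Set (Language Bool) :=
  {L | ∃ L' ∈ C, ∃ p : Polynomial ℕ, ∀ x : List Bool,
    x ∈ L ↔ 1 / 2 < uniformProb (p.eval x.length) {y : List Bool | boolPair x y ∈ L'}}

/-! ### The classes BPP, RP, coRP, ZPP, PP, AM -/

/-- The class `BPP = bp P` of languages decidable in probabilistic polynomial time with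
two-sided error at most `1/3`. [Gill 1977, Def. 5.2; Arora–Barak 2009, Def. 7.2–7.3] [cite: Gill1977, Def. 5.2] -/
noncomputable def BPP : Set (Language Bool) :=
  bp Classes.P

/-- The class `RP = rp P` of languages decidable in probabilistic polynomial time with
one-sided error (no false positives, false negatives with probability at most `1/2`).
[Gill 1977, Def. 5.1 (VPP); Arora–Barak 2009, Def. 7.6] [cite: Gill1977, Def. 5.1 (VPP] -/
noncomputable def RP : Set (Language Bool) :=
  rp Classes.P

/-- The class `coRP = co RP = {L | Lᶜ ∈ RP}`. [Arora–Barak 2009, Def. 7.6] [cite: AroraBarak2009, Def. 7.6] -/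
noncomputable def coRP : Set (Language Bool) :=
  co RP

/-- The class `ZPP` of zero-error probabilistic polynomial time, defined here as `RP ∩ coRP`.
Theorem-as-definition: Gill defines `ZPP` by zero-error machines with expected polynomial
running time and proves `ZPP = RP ∩ coRP`; the expected-time form is `mem_ZPP_iff_expectedTime`.
[Gill 1977, Def. 5.2 and Thm. 5.2(ii); Arora–Barak 2009, Def. 7.7 and Thm. 7.8] [cite: Gill1977, Def. 5.2 and Thm. 5.2(ii] -/
noncomputable def ZPP : Set (Language Bool) :=
  RP ∩ coRP

/-- The class `PP = pMajority P` of languages decidable in probabilistic polynomial time by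
majority vote (unbounded error, strict threshold `> 1/2` as in Gill).
[Gill 1977, Def. 5.1; Arora–Barak 2009, §17.2.1] [cite: Gill1977, Def. 5.1] -/
noncomputable def PP : Set (Language Bool) :=
  pMajority Classes.P

/-- The class `AM = bp NP`, i.e. the operator class `BP·NP`. It equals the class of languages
with two-round public-coin Arthur–Merlin games (and, by Goldwasser–Sipser, with constant-round
private-coin interactive proofs). [Babai–Moran 1988, JCSS 36; Goldwasser–Sipser 1986;
Arora–Barak 2009, Def. 8.10 and Remark 8.11] [cite: BabaiMoran1988, JCSS 36] -/
noncomputable def AM : Set (Language Bool) :=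
  bp Nondeterministic.NP

/-! ### API -/

/-- `bp` is monotone in the class. [Schöning 1989; Arora–Barak 2009, Def. 7.3] [cite: Schoning1989] -/
theorem bp_mono {C D : Set (Language Bool)} (h : C ⊆ D) : bp C ⊆ bp D := by
  rintro L ⟨L', hL', p, hp⟩
  exact ⟨L', h hL', p, hp⟩

/-- `rp` is monotone in the class. [Arora–Barak 2009, Def. 7.6] [cite: AroraBarak2009, Def. 7.6] -/
theorem rp_mono {C D : Set (Language Bool)} (h : C ⊆ D) : rp C ⊆ rp D := by
  rintro L ⟨L', hL', p, hp⟩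
  exact ⟨L', h hL', p, hp⟩

/-- `pMajority` is monotone in the class. [Gill 1977, Def. 5.1] [cite: Gill1977, Def. 5.1] -/
theorem pMajority_mono {C D : Set (Language Bool)} (h : C ⊆ D) :
    pMajority C ⊆ pMajority D := by
  rintro L ⟨L', hL', p, hp⟩
  exact ⟨L', h hL', p, hp⟩

/-- `P ⊆ BPP` (ignore the coins: `L' = {boolPair x y | x ∈ L} ∈ P` when `L ∈ P`, and then every
coin string is correct). [Gill 1977, Prop. 5.1; Arora–Barak 2009, §7.1] [cite: Gill1977, Prop. 5.1] -/
def P_subset_BPP : Prop :=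
  Classes.P ⊆ BPP

/-- `RP ⊆ NP` (a good coin string is a certificate: from `L' ∈ P` and `p` take the verifier
`{boolPair x y | |y| = p |x| ∧ boolPair x y ∈ L'} ∈ P`; if `x ∈ L` the accepting set has
positive probability hence is nonempty). [Arora–Barak 2009, §7.3 (RP ⊆ NP); Gill 1977,
Thm. 6.5] [cite: AroraBarak2009, §7.3 (RP ⊆ NP] -/
def RP_subset_NP : Prop :=
  RP ⊆ Nondeterministic.NP

/-- `RP ⊆ BPP` (run twice with independent coins to push the one-sided error below `1/3`;
requires closure of `P` under this pairing). [Arora–Barak 2009, §7.3; Gill 1977, Thm. 6.5] [cite: AroraBarak2009, §7.3] -/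
def RP_subset_BPP : Prop :=
  RP ⊆ BPP

/-- `BPP ⊆ PP` (a `2/3`-majority is a strict majority; the languages `L'` must be adjusted so
that `x ∉ L` gives at most `1/3 < 1/2` acceptance, which is literally the `bp` condition).
[Gill 1977, Prop. 5.1] [cite: Gill1977, Prop. 5.1] -/
def BPP_subset_PP : Prop :=
  BPP ⊆ PP

/-- `NP ⊆ PP` (accept if the first coin is `1`, or else if the remaining coins form a
certificate; padding witnesses to exact length). [Gill 1977, Thm. 6.5 (NP ⊆ PP)] [cite: Gill1977, Thm. 6.5 (NP ⊆ PP] -/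
def NP_subset_PP : Prop :=
  Nondeterministic.NP ⊆ PP

/-- `BPP` is closed under complement: `co BPP = BPP` (swap the verdict, using `co P = P`; the
event `{y | boolPair x y ∈ L'ᶜ ↔ x ∈ Lᶜ}` equals `{y | boolPair x y ∈ L' ↔ x ∈ L}`).
[Arora–Barak 2009, §7.1 (BPP = coBPP); Gill 1977, Prop. 5.1] [cite: AroraBarak2009, §7.1 (BPP = coBPP] -/
def co_BPP : Prop :=
  co BPP = BPP

/-- Gill's machine form of `BPP`: `L ∈ BPP` iff some probabilistic polynomial-time algorithm
`A : RandAlg (List Bool) Bool`, using exactly `q |x|` coins for a polynomial `q`, outputs the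
correct bit `[x ∈ L]` with probability at least `2/3` on every input `x`.

The coin budget must be *literally a polynomial* (Arora–Barak Def. 7.3: "`p(|x|)` random
bits"), not merely polynomially bounded as in `RandAlg.IsPolyTime`: otherwise a
non-computable `coinLen : ℕ → ℕ` (read off by `A.run` from `|r|`) would decide uncountably
many languages and the `←` direction would fail. (From operator form to machine form:
`coinLen := p.eval`, `run x r := [boolPair x r ∈ L']`; conversely,
`L' := {boolPair x r | |r| = q |x| ∧ A.run x r = true} ∈ P` and `p := q`.)
[Gill 1977, Def. 5.2; Arora–Barak 2009, Def. 7.2 ↔ Def. 7.3] [cite: Gill1977, Def. 5.2] -/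
def mem_BPP_iff_randAlg : Prop :=
  ∀ {L : Language Bool},
    L ∈ BPP ↔ ∃ A : RandAlg (List Bool) Bool,
      A.IsPolyTime id encodeBool ∧ (∃ q : Polynomial ℕ, ∀ n, A.coinLen n = q.eval n) ∧
        ∀ x : List Bool, 2 / 3 ≤ A.pr id x {L.boolIndicator x}

/-- Gill's definition of `ZPP` as a characterisation: `L ∈ ZPP = RP ∩ coRP` iff some zero-error
randomized algorithm `A : RandAlg (List Bool) Bool`, using exactly `q |x|` coins for a
polynomial `q`, decides `L` correctly on *every* coin string of the prescribed length and runs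
in expected polynomial time `p |x|` (`RandAlg.RunsInExpectedTime`, mean over the coin strings
of a pointwise step bound). As in `mem_BPP_iff_randAlg`, the coin budget is an exact
polynomial (a merely bounded, possibly non-computable `coinLen` would make `←` false); the time
polynomial `p` is separate from `q` so that it can dominate the machine-input length
`2|x| + 2 + q |x|`. (`→`: run `q(n)+1` independent `RP`/`coRP` trials and brute-force on the
exponentially rare indecisive coin strings; `←`: truncate at `2 p |x|` steps and use Markov's
inequality.) [Gill 1977, Def. 5.2 (ZPP) and Thm. 5.2(ii) (`ZPP = RP ∩ coRP`); Arora–Barak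
2009, Def. 7.7 and Thm. 7.8] [cite: Gill1977, Def. 5.2 (ZPP] -/
def mem_ZPP_iff_expectedTime : Prop :=
  ∀ {L : Language Bool},
    L ∈ ZPP ↔ ∃ A : RandAlg (List Bool) Bool,
      (∃ p q : Polynomial ℕ,
        A.RunsInExpectedTime id encodeBool (fun x => ((p.eval x.length : ℕ) : ℝ)) ∧
        ∀ n, A.coinLen n = q.eval n) ∧
      ∀ (x : List Bool) (r : List Bool), r.length = A.coinLen x.length →
        A.run x r = L.boolIndicator x

/-! ### Error reduction and the coin-truncation normal form

Named facts (D-0014) and a normal form serving the average-case inclusion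
`(BPP, 𝒟) ⊆ HeurBPP` (`Literature/Computability/MetaComplexity/HeuristicClasses.lean`), whose inner
threshold `1/4` on the coin error is below the `1/3` of `BPP`. -/

namespace RandAlg

variable {α β : Type}

/-- The *coin-truncated* form of a randomized algorithm: `A.truncate ea` runs `A` on the first
`coinLen |ea x|` coins only, `run x r := A.run x (r.take (A.coinLen |ea x|))`, with the same coin
budget. It has the same output distributions as `A` (`outputPMF_truncate`, `pr_truncate`) and its
output depends only on the prescribed coins (`truncate_run_take`). This is the normal form in
which a probabilistic machine is a deterministic machine `M(x, r)` reading *exactly* the random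
string `r ∈ {0,1}^{p(|x|)}` (Arora–Barak's alternative definition); in `RandAlg`, whose `run` is a
total function of all coin strings, it has to be imposed by truncation (cf. the design note on
`IsPolyTime` in `Randomized.lean`). [Arora–Barak 2009, Def. 7.3 (`M(x, r)`, `r ∈ {0,1}^{p(|x|)}`);
Gill 1977, §2] [cite: AroraBarak2009, Def. 7.3] -/
def truncate (A : RandAlg α β) (ea : α → List Bool) : RandAlg α β where
  run x r := A.run x (r.take (A.coinLen (ea x).length))
  coinLen := A.coinLen

/-- The coin budget of the truncated algorithm is unchanged (definitional). [folklore] -/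
@[simp] theorem truncate_coinLen (A : RandAlg α β) (ea : α → List Bool) :
    (A.truncate ea).coinLen = A.coinLen :=
  rfl

/-- The truncated algorithm runs `A` on the first `coinLen |ea x|` coins (definitional). [folklore] -/
@[simp] theorem truncate_run (A : RandAlg α β) (ea : α → List Bool) (x : α) (r : List Bool) :
    (A.truncate ea).run x r = A.run x (r.take (A.coinLen (ea x).length)) :=
  rfl

/-- The truncated algorithm is *coin-oblivious*: its output depends only on the first
`coinLen |ea x|` coins. [Arora–Barak 2009, Def. 7.3] [cite: AroraBarak2009, Def. 7.3] -/
theorem truncate_run_take (A : RandAlg α β) (ea : α → List Bool) (x : α) (r : List Bool) :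
    (A.truncate ea).run x (r.take ((A.truncate ea).coinLen (ea x).length)) =
      (A.truncate ea).run x r := by
  simp [List.take_take]

/-- Truncation does not change the output distribution (the sampled coin strings have exactly
the prescribed length, on which `take` is the identity). [Arora–Barak 2009, Def. 7.3] [cite: AroraBarak2009, Def. 7.3] -/
@[simp] theorem outputPMF_truncate (A : RandAlg α β) (ea : α → List Bool) :
    (A.truncate ea).outputPMF ea = A.outputPMF ea := by
  funext x
  simp only [outputPMF, truncate]
  congr 1
  funext r
  rw [List.take_of_length_le (le_of_eq r.toList_length)]

/-- Truncation does not change the probability of any event. [Arora–Barak 2009, Def. 7.3] [cite: AroraBarak2009, Def. 7.3] -/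
@[simp] theorem pr_truncate (A : RandAlg α β) (ea : α → List Bool) :
    (A.truncate ea).pr ea = A.pr ea := by
  funext x E
  simp only [pr, outputPMF_truncate]

/-- For a Boolean-valued randomized algorithm, the probability of missing the bit `c` is one
minus the probability of hitting it: `Pr[A(x) ≠ c] = 1 - Pr[A(x) = c]`.
[Arora–Barak 2009, §7.1; Mathlib `PMF.tsum_coe`] [folklore] -/
theorem pr_ne_eq_one_sub (A : RandAlg α Bool) (ea : α → List Bool) (x : α) (c : Bool) :
    A.pr ea x {b | b ≠ c} = 1 - A.pr ea x {c} := by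
  have hset : {b : Bool | b ≠ c} = {!c} := by
    ext b
    cases b <;> cases c <;> simp
  set p := A.outputPMF ea x with hp
  have hsum : p c + p (!c) = 1 := by
    have h := p.tsum_coe
    rw [tsum_fintype, Fintype.sum_bool] at h
    cases c
    · simpa [add_comm] using h
    · simpa using h
  have hc : p (!c) = 1 - p c :=
    ENNReal.eq_sub_of_add_eq (PMF.apply_ne_top p c) (by rw [add_comm]; exact hsum)
  simp only [pr, ← hp, hset, PMF.toOuterMeasure_apply_singleton, hc]
  rw [ENNReal.toReal_sub_of_le (p.coe_le_one c) ENNReal.one_ne_top, ENNReal.toReal_one]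

end RandAlg

/-- **Coin truncation is polynomial time** (the machine content of the normal form
`RandAlg.truncate`): for every polynomial `q`, the string map `⟨u, r⟩ ↦ ⟨u, r↾q(|u|)⟩` keeping the
first `q(|u|)` symbols of the second component of a `boolPair` is polynomial-time computable
(count off `q(|u|)` — a polynomial, hence time-constructible, clock — while copying `r`).
A routine machine construction, not in Mathlib; stated w.r.t. the pairing `boolPair` on both
sides so that it composes with `RandAlg.IsPolyTime` (`PolyTimeComputable.comp`).
[Arora–Barak 2009, §1.3 (time-constructible functions: all polynomials) and §0.1 (pairing)] [cite: AroraBarak2009, §1.3] -/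
def polyTimeComputable_boolPair_take : Prop :=
  ∀ q : Polynomial ℕ,
    PolyTimeComputable (Function.uncurry boolPair) (Function.uncurry boolPair)
      fun p : List Bool × List Bool => (p.1, p.2.take (q.eval p.1.length))

/-- **Error reduction for `BPP` down to any constant** (machine form). If `L ∈ BPP` then for
every `ε > 0` there is a probabilistic polynomial-time algorithm `A : RandAlg (List Bool) Bool`,
using exactly `q |x|` coins for some polynomial `q`, with `Pr_r[A(x, r) = [x ∈ L]] ≥ 1 - ε` for
**every** input `x` — "we can replace `2/3` with any constant larger than `1/2`" (run the machine
`k = O(log 1/ε)` times with independent coins and take the majority vote; Chernoff, or already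
Chebyshev for constant `ε`). This is literally Sipser's amplification lemma (Lemma 10.5) with
a *constant* polynomial `poly(n) = ⌈log₂ (1/ε)⌉`, and a corollary — not an instance — of
Arora–Barak's Thm. 7.10 (which needs `d > 0`; the finitely many short inputs where
`2^{-|x|^d} > ε` are hard-wired) and of the remark of §7.4.1 that `2/3` may be replaced by any
constant `> 1/2`; the full strength `1 - 2^{-|x|^d}` is not asserted here. The machine form is
that of `mem_BPP_iff_randAlg`.
[Arora–Barak 2009, §7.4.1 (p. 132) and Thm. 7.10 (error reduction for BPP), with Def. 7.3;
Sipser, *Introduction to the Theory of Computation*, 3rd ed., Lemma 10.5 (amplification lemma)]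
[cite: AroraBarak2009, Thm. 7.10 and §7.4.1] -/
def exists_randAlg_error_le_of_mem_BPP : Prop :=
  ∀ {L : Language Bool}, L ∈ BPP → ∀ ε : ℝ, 0 < ε →
    ∃ A : RandAlg (List Bool) Bool,
      A.IsPolyTime id encodeBool ∧ (∃ q : Polynomial ℕ, ∀ n, A.coinLen n = q.eval n) ∧
        ∀ x : List Bool, 1 - ε ≤ A.pr id x {L.boolIndicator x}

end Literature.Computability.Complexity
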